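import Literature.MathematicalPhysics.QuantumFieldTheory.Balaban1983to89.B9Thm311PosDefAveragingSwapClose
import Literature.MathematicalPhysics.QuantumFieldTheory.Balaban1983to89.B9Eq3115KnitLetterYRowCloseness

/-!
# `Balaban1983to89.B9Thm311PosDefQknitOfRegYP335AtLettersY` — T. Bałaban, *Propagators for lattice gauge theories in a background field*, Commun. Math. Phys.
# **99** (1985) 389–434 [Balaban1985BackgroundPropagators], THEOREM 3.11 p. 416 FOR `Δ_a` AT PRINT's AVERAGING LETTER `Q(U) = QknitY`: `Δ_a^{Q(U)}(U)` is
# positive definite on the class (3.35) at every section-carrying member, under x-free numerics only — row 17 of the N06 certificate at `𝔮 := qKnitOfRecord`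

statement-level skeleton of published theorems with citation tags; proofs where landed; nothing here is a claim about the Yang–Mills mass gap

THE PRINT.  Thm 3.11 p. 416; (3.26) p. 395; (3.12)–(3.13) p. 392, (3.14)–(3.15) p. 393; (3.115) p. 419 (print's averaging is the composite one of [5] =
*Averaging operations …*, CMP **98** (1985), (139)–(147) pp. 39–40); [4] = *Propagators … II*, CMP **96** (1984), (2.2)–(2.4) p. 224, (2.16)∕(2.20) pp. 225–226.
WHY (cell `pub-ymgap`, N06, seat `dag-n06-j` = F5, gen 35; director-ym №375 «R2-A»: row 17 is the one F5 face that moves).  The chain `…FormGapOfRegYP335AtLettersY` (γ) →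
`…PosDefAveragingSwap` (transfer) → `B9Eq315QYSizeWeightedL2Y` (K′) → dag-n06-c's `B9Eq315QLetterL2SizeFromClosenessY` (K eliminated) → `…AveragingSwapClose`
(rebased reference) left ONE ℓ²-closeness display; dag-n06-l's `B9Eq3115KnitLetterYRowCloseness` supplies it IN ROW FORM with mass-bounded level-windowed
kernels; THIS FILE converts rows to the `trIP` currency (convexity, op → HS at cost `N`, band + level window as in `B9Eq315QYSizeWeightedL2Y`) and closes the
chain: row 17 at `deltaAQY x (QknitY x) 𝔮s parSymY (GpY parSymY)` at section-carrying members from the adjointness of `𝔮s` and x-free numerics ONLY.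

WHAT IS PROVED (sorry-free; 0 `def`).  §1 `sq_sum_mul_le_mass`, ★ `hs_le_of_norm_le_sum` (op-norm row bound ⟹ HS row bound, cost `N`); §2 the kernel
`q̃ = K·boxK + 8(d+2)²·qK`: `qtilde_rowMass_le` (`≤ m₀ = 2(d+1)K + 8(d+2)²`), `lvl_eq_or_eq_succ_of_boxK_ne_zero`, `sum_filter_w_mul_boxK_le`, `colWeight_boxK_le`,
★ `qtilde_colWeight_le` (`≤ 2b₁m₀c_f²(L^{lev f})⁻²`); §3 `rebaseRef_apply`, ★ `hs_row_QknitY_sub_rebase_le`, ★★ `trIP_w_QknitY_sub_rebase_le` (THE ℓ² CLOSENESS,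
`δ² = (α₀′m₀)²·2Nb₁`); §4 ★★★ `posDefTr_deltaAQY_QknitY_of_regYP335_section` ∕ `_at_scMemberY` (row 17 at the knit letter from adjointness + numerics).
HONEST SCOPE.  A composition of LANDED theorems by name; the knit-letter estimates are dag-n06-l's ∕ J-B's ∕ t2s-1's, the gap is Thm 3.3's block via this
lineage's gen-31 road; section-carrying members only; NOT a node discharge; count-neutral; nothing continuum ∕ OS ∕ mass gap ∕ Clay.
No `sorry`, no `axiom`, no `instance`, no `notation`, no `def`.
-/

noncomputable section

namespace Literature.MathematicalPhysics.QuantumFieldTheory.Balaban1983to89.B9Thm311PosDefQknitOfRegYP335AtLettersY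

open Literature.MathematicalPhysics.QuantumFieldTheory.Balaban1983to89
open B9Thm311ReadingCoords B9Thm39ReadingCoords B9Thm39ReadingAtLetters Node00
open B6KLevelCensusIndexV1 B6Ineq2142KLevelV1 B6GlobalChartV1 B9PinMembersKLevelV1 B9PinGeometryKLevelV1 B9GeoNormsKLevelV1
  B9BackgroundsKLevelV1 B9BackgroundsKLevelV1P B9Thm34Ext
open B9Thm311FormGapOfRegYP335AtLettersY B9Thm311PosDefAveragingSwap B9Eq315QYSizeWeightedL2Y B9Thm311PosDefAveragingSwapClose
open B9Eq3115KnitLetterYRowCloseness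
open Literature.MathematicalPhysics.QuantumFieldTheory.Balaban1983to89.B9Thm311DeltaPrimePos (trIP_self_nonneg trIP_self_pos)
open Literature.MathematicalPhysics.QuantumFieldTheory.Balaban1983to89.B9Ineq369CurvatureSmallAtLettersY (hs_nonneg)
open Literature.MathematicalPhysics.QuantumFieldTheory.Balaban1983to89.B9Thm311FlippedBondForms (trIP_self_eq_sum qK_nonneg)
open Literature.MathematicalPhysics.QuantumFieldTheory.Balaban1983to89.B9Eq3132Ineq2142Covariant (two_le_RMh)
open Literature.MathematicalPhysics.QuantumFieldTheory.Balaban1983to89.B9GeoLemma21KLevelV1 (one_le_k)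
open Literature.MathematicalPhysics.QuantumFieldTheory.Balaban1983to89.B9SectionCarryingMembersV1 (SCMemberY)
open Literature.MathematicalPhysics.QuantumFieldTheory.Balaban1983to89.B9Eq3115KnitLetterY (QknitY zSrc)
open Literature.MathematicalPhysics.QuantumFieldTheory.Balaban1983to89.B9Eq3115KnitLetterYOnto (kCol kCol_nonneg)
open Literature.MathematicalPhysics.QuantumFieldTheory.Balaban1983to89.B9Eq316AveragingTransposeZd (alphaQ)
open Literature.MathematicalPhysics.QuantumFieldTheory.Balaban1983to89.B9C2FormBoxRegimeY (Kpl)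
open scoped InnerProductSpace

/-! ## §1 From a row bound in operator norm to a Hilbert–Schmidt row bound -/

section Row

open scoped Matrix.Norms.L2Operator

variable {X : Type} [Fintype X] {N : ℕ}

/-- Cauchy–Schwarz with a nonnegative kernel: `(Σ_x c_x z_x)² ≤ (Σ_x c_x)·Σ_x c_x z_x²`. [cite: Balaban1984PropagatorsI, (1.18) p.20, bookkeeping] -/
theorem sq_sum_mul_le_mass (c : X → ℝ) (hc : ∀ x, 0 ≤ c x) (z : X → ℝ) :
    (∑ x, c x * z x) ^ 2 ≤ (∑ x, c x) * ∑ x, c x * z x ^ 2 := by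
  have hcs := Finset.sum_mul_sq_le_sq_mul_sq Finset.univ (fun x => Real.sqrt (c x)) (fun x => Real.sqrt (c x) * z x)
  have e1 : ∀ x, Real.sqrt (c x) * (Real.sqrt (c x) * z x) = c x * z x := fun x => by
    rw [← mul_assoc, Real.mul_self_sqrt (hc x)]
  have e2 : ∀ x, Real.sqrt (c x) ^ 2 = c x := fun x => Real.sq_sqrt (hc x)
  have e3 : ∀ x, (Real.sqrt (c x) * z x) ^ 2 = c x * z x ^ 2 := fun x => by rw [mul_pow, Real.sq_sqrt (hc x)]
  simp only [e1, e2, e3] at hcs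
  exact hcs

/-- ★ **OP-NORM ROW BOUND ⟹ HS ROW BOUND** (cost `N`): `‖Y‖ ≤ Σ_f c_f‖a_f‖`, `c ≥ 0` ⟹ `HS(Y) ≤ N·(Σ_f c_f)·Σ_f c_f·HS(a_f)`. [cite: Balaban1985Averaging, (17)–(20) pp.20–21, bookkeeping] -/
theorem hs_le_of_norm_le_sum (Y : Matrix (Fin N) (Fin N) ℂ) (c : X → ℝ) (hc : ∀ x, 0 ≤ c x) (a : X → Matrix (Fin N) (Fin N) ℂ)
    (h : ‖Y‖ ≤ ∑ x, c x * ‖a x‖) :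
    ∑ p, ∑ q, ‖Y p q‖ ^ 2 ≤ (N : ℝ) * (∑ x, c x) * ∑ x, c x * ∑ p, ∑ q, ‖a x p q‖ ^ 2 := by
  have hY0 : 0 ≤ ‖Y‖ := norm_nonneg _
  have h1 : ∑ p, ∑ q, ‖Y p q‖ ^ 2 ≤ (N : ℝ) * ‖Y‖ ^ 2 := by
    calc ∑ p, ∑ q, ‖Y p q‖ ^ 2 = ∑ q, ∑ p, ‖Y p q‖ ^ 2 := Finset.sum_comm
      _ ≤ ∑ _q : Fin N, ‖Y‖ ^ 2 := Finset.sum_le_sum fun q _ => MatrixNorms.sum_norm_sq_col_le_opNorm_sq Y q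
      _ = (N : ℝ) * ‖Y‖ ^ 2 := by rw [Finset.sum_const, Finset.card_univ, Fintype.card_fin, nsmul_eq_mul]
  have h2 : ‖Y‖ ^ 2 ≤ (∑ x, c x) * ∑ x, c x * ‖a x‖ ^ 2 :=
    (pow_le_pow_left₀ hY0 h 2).trans (sq_sum_mul_le_mass c hc _)
  have h3 : ∑ x, c x * ‖a x‖ ^ 2 ≤ ∑ x, c x * ∑ p, ∑ q, ‖a x p q‖ ^ 2 :=
    Finset.sum_le_sum fun x _ => mul_le_mul_of_nonneg_left (MatrixNorms.opNorm_sq_le_sum_norm_sq (a x)) (hc x)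
  have hm : 0 ≤ ∑ x, c x := Finset.sum_nonneg fun x _ => hc x
  calc ∑ p, ∑ q, ‖Y p q‖ ^ 2 ≤ (N : ℝ) * ‖Y‖ ^ 2 := h1
    _ ≤ (N : ℝ) * ((∑ x, c x) * ∑ x, c x * ‖a x‖ ^ 2) := mul_le_mul_of_nonneg_left h2 (Nat.cast_nonneg N)
    _ ≤ (N : ℝ) * ((∑ x, c x) * ∑ x, c x * ∑ p, ∑ q, ‖a x p q‖ ^ 2) :=
        mul_le_mul_of_nonneg_left (mul_le_mul_of_nonneg_left h3 hm) (Nat.cast_nonneg N)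
    _ = (N : ℝ) * (∑ x, c x) * ∑ x, c x * ∑ p, ∑ q, ‖a x p q‖ ^ 2 := by ring

end Row

/-! ## §2 The closeness kernel `q̃_ι(f) = K·boxK ι f + 8(d+2)²·q_ι(f)`: row mass and column weight -/

section Kernel

variable {d ℓ : ℕ} {hd : 1 ≤ d + 1} {hL : Odd (ℓ + 1) ∧ 1 < ℓ + 1} {b₀ b₁ : ℝ}
variable (i : KIdx d ℓ hd hL b₀ b₁)

/-- the kernel is nonnegative. [cite: Balaban1985Averaging, (139) p.39, bookkeeping] -/
theorem qtilde_nonneg (ι : IBondY i) (f : FBondY i) :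
    0 ≤ kCol (d + 1) (ℓ + 1) * boxK i ι f + 8 * ((d : ℝ) + 2) ^ 2 * qK i ι f :=
  add_nonneg (mul_nonneg (kCol_nonneg _ _) (boxK_nonneg i ι f)) (mul_nonneg (by positivity) (qK_nonneg i ι f))

/-- **ROW MASS** `Σ_f q̃_ι(f) ≤ m₀ := 2(d+1)K + 8(d+2)²` (`Σ_f boxK ι f ≤ 2(d+1)`, `Σ_f q_ι(f) = 1`). [cite: Balaban1985Averaging, p.24, (140) p.39; Balaban1984PropagatorsI, (1.18) p.20] -/
theorem qtilde_rowMass_le (ι : IBondY i) :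
    ∑ f, (kCol (d + 1) (ℓ + 1) * boxK i ι f + 8 * ((d : ℝ) + 2) ^ 2 * qK i ι f)
      ≤ 2 * ((d : ℝ) + 1) * kCol (d + 1) (ℓ + 1) + 8 * ((d : ℝ) + 2) ^ 2 := by
  rw [Finset.sum_add_distrib, ← Finset.mul_sum, ← Finset.mul_sum, sum_qK_eq_one i ι, mul_one]
  have h := mul_le_mul_of_nonneg_left (sum_boxK_le i ι) (kCol_nonneg (d + 1) (ℓ + 1))
  linarith

/-- the level window of the box kernel: `boxK ι f ≠ 0 ⟹ lvl ι ∈ {lev f, lev f + 1}` (`iterBlockOf_of_boxK_ne_zero` + `lev_ends_bounds`). [cite: Balaban1984PropagatorsII, (2.2)–(2.4) p.224] -/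
theorem lvl_eq_or_eq_succ_of_boxK_ne_zero {ι : IBondY i} {f : FBondY i} (h : boxK i ι f ≠ 0) :
    lvl i.hN i.D i.hk ι = levV1 i f.src ∨ lvl i.hN i.D i.hk ι = levV1 i f.src + 1 := by
  have hends := iterBlockOf_of_boxK_ne_zero i h
  have hb := lev_ends_bounds i.hN i.D i.hk (one_le_k i) (two_le_RMh i) ι hends
  have h1 : 1 ≤ lvl i.hN i.D i.hk ι := one_le_lvl i.hN i.D i.hk (one_le_k i) ι
  change lvl i.hN i.D i.hk ι - 1 ≤ levV1 i f.src ∧ levV1 i f.src ≤ lvl i.hN i.D i.hk ι at hb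
  omega

/-- level-`J` box column weight `Σ_{lvl ι = J} w(ι)·boxK ι f ≤ 2(d+1)b₁c_f²(L^J)⁻²` (band × column mass). [cite: Balaban1984PropagatorsII, (2.20) p.226; Balaban1985Averaging, p.24] -/
theorem sum_filter_w_mul_boxK_le (hb₁ : 0 ≤ b₁) (J : ℕ) (f : FBondY i) :
    ∑ ι ∈ Finset.univ.filter (fun ι : IBondY i => lvl i.hN i.D i.hk ι = J), i.w ι * boxK i ι f
      ≤ 2 * ((d : ℝ) + 1) * b₁ * (i.cf ^ 2 * ((((ℓ : ℝ) + 1) ^ J)⁻¹) ^ 2) := by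
  have hterm : ∀ ι ∈ Finset.univ.filter (fun ι : IBondY i => lvl i.hN i.D i.hk ι = J),
      i.w ι * boxK i ι f ≤ (b₁ * ((((ℓ + 1 : ℕ) : ℝ)) ^ (d + 1)) ^ J * (i.cf ^ 2 * ((((ℓ : ℝ) + 1) ^ J)⁻¹) ^ 2)) * boxK i ι f := by
    intro ι hι
    have hJ : lvl i.hN i.D i.hk ι = J := (Finset.mem_filter.1 hι).2
    refine mul_le_mul_of_nonneg_right ?_ (boxK_nonneg i ι f)
    have h := w_le_band i ι
    have hv : B9SectBGWordDeltaAY.volY i ι = ((((ℓ + 1 : ℕ) : ℝ)) ^ (d + 1)) ^ J := by unfold B9SectBGWordDeltaAY.volY; rw [← hJ]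
    rw [hv, hJ] at h
    exact h
  refine (Finset.sum_le_sum hterm).trans ?_
  rw [← Finset.mul_sum]
  have hcol := sum_filter_lvl_boxK_le i J f
  have hc : 0 ≤ b₁ * ((((ℓ + 1 : ℕ) : ℝ)) ^ (d + 1)) ^ J * (i.cf ^ 2 * ((((ℓ : ℝ) + 1) ^ J)⁻¹) ^ 2) := by positivity
  have hvolJ : (0 : ℝ) < ((((ℓ + 1 : ℕ) : ℝ)) ^ (d + 1)) ^ J := by positivity
  calc b₁ * ((((ℓ + 1 : ℕ) : ℝ)) ^ (d + 1)) ^ J * (i.cf ^ 2 * ((((ℓ : ℝ) + 1) ^ J)⁻¹) ^ 2)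
        * ∑ ι ∈ Finset.univ.filter (fun ι : IBondY i => lvl i.hN i.D i.hk ι = J), boxK i ι f
      ≤ b₁ * ((((ℓ + 1 : ℕ) : ℝ)) ^ (d + 1)) ^ J * (i.cf ^ 2 * ((((ℓ : ℝ) + 1) ^ J)⁻¹) ^ 2)
          * (2 * ((d : ℝ) + 1) * (((((ℓ + 1 : ℕ) : ℝ)) ^ (d + 1)) ^ J)⁻¹) := mul_le_mul_of_nonneg_left hcol hc
    _ = 2 * ((d : ℝ) + 1) * b₁ * (i.cf ^ 2 * ((((ℓ : ℝ) + 1) ^ J)⁻¹) ^ 2) := by field_simp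

open Classical in
/-- box column weight `Σ_ι w(ι)·boxK ι f ≤ 4(d+1)b₁c_f²(L^{lev f})⁻²` (two levels). [cite: Balaban1985Averaging, p.24; Balaban1984PropagatorsII, (2.20) p.226] -/
theorem colWeight_boxK_le (hb₁ : 0 ≤ b₁) (f : FBondY i) :
    ∑ ι, i.w ι * boxK i ι f ≤ 4 * ((d : ℝ) + 1) * b₁ * (i.cf ^ 2 * ((((ℓ : ℝ) + 1) ^ levV1 i f.src)⁻¹) ^ 2) := by
  set j := levV1 i f.src with hj
  have hsplit : ∑ ι, i.w ι * boxK i ι f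
      = ∑ ι ∈ Finset.univ.filter (fun ι : IBondY i => lvl i.hN i.D i.hk ι = j ∨ lvl i.hN i.D i.hk ι = j + 1), i.w ι * boxK i ι f := by
    refine (Finset.sum_subset (Finset.filter_subset _ _) fun ι _ hι => ?_).symm
    have hq : boxK i ι f = 0 := by
      by_contra hne
      exact hι (Finset.mem_filter.2 ⟨Finset.mem_univ _, lvl_eq_or_eq_succ_of_boxK_ne_zero i hne⟩)
    rw [hq, mul_zero]
  have hunion : Finset.univ.filter (fun ι : IBondY i => lvl i.hN i.D i.hk ι = j ∨ lvl i.hN i.D i.hk ι = j + 1)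
      = Finset.univ.filter (fun ι : IBondY i => lvl i.hN i.D i.hk ι = j) ∪ Finset.univ.filter (fun ι : IBondY i => lvl i.hN i.D i.hk ι = j + 1) :=
    Finset.filter_or _ _ _
  have hdisj : Disjoint (Finset.univ.filter (fun ι : IBondY i => lvl i.hN i.D i.hk ι = j))
      (Finset.univ.filter (fun ι : IBondY i => lvl i.hN i.D i.hk ι = j + 1)) := by
    rw [Finset.disjoint_filter]
    intro ι _ h1 h2
    omega
  rw [hsplit, hunion, Finset.sum_union hdisj]
  have h1 := sum_filter_w_mul_boxK_le i hb₁ j f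
  have h2 := sum_filter_w_mul_boxK_le i hb₁ (j + 1) f
  have hL1 : (1 : ℝ) ≤ (ℓ : ℝ) + 1 := by have : (0 : ℝ) ≤ ℓ := Nat.cast_nonneg _; linarith
  have hmono : (i.cf ^ 2 * ((((ℓ : ℝ) + 1) ^ (j + 1))⁻¹) ^ 2) ≤ (i.cf ^ 2 * ((((ℓ : ℝ) + 1) ^ j)⁻¹) ^ 2) := by
    refine mul_le_mul_of_nonneg_left ?_ (sq_nonneg _)
    have hpj : (0 : ℝ) < ((ℓ : ℝ) + 1) ^ j := pow_pos (lt_of_lt_of_le one_pos hL1) _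
    have hle : ((ℓ : ℝ) + 1) ^ j ≤ ((ℓ : ℝ) + 1) ^ (j + 1) := pow_le_pow_right₀ hL1 (Nat.le_succ j)
    have hinv : (((ℓ : ℝ) + 1) ^ (j + 1))⁻¹ ≤ (((ℓ : ℝ) + 1) ^ j)⁻¹ := inv_anti₀ hpj hle
    exact pow_le_pow_left₀ (inv_nonneg.2 (hpj.le.trans hle)) hinv 2
  have hd0 : (0 : ℝ) ≤ 2 * ((d : ℝ) + 1) * b₁ := by positivity
  have h2' : ∑ ι ∈ Finset.univ.filter (fun ι : IBondY i => lvl i.hN i.D i.hk ι = j + 1), i.w ι * boxK i ι f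
      ≤ 2 * ((d : ℝ) + 1) * b₁ * (i.cf ^ 2 * ((((ℓ : ℝ) + 1) ^ j)⁻¹) ^ 2) := h2.trans (mul_le_mul_of_nonneg_left hmono hd0)
  linarith

/-- ★ column weight of the closeness kernel `Σ_ι w(ι)q̃_ι(f) ≤ 2b₁m₀c_f²(L^{lev f})⁻²`, `m₀ = 2(d+1)K + 8(d+2)²`. [cite: Balaban1985BackgroundPropagators, (3.15) p.393; Balaban1984PropagatorsII, (2.20) p.226] -/
theorem qtilde_colWeight_le (hb₁ : 0 ≤ b₁) (f : FBondY i) :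
    ∑ ι, i.w ι * (kCol (d + 1) (ℓ + 1) * boxK i ι f + 8 * ((d : ℝ) + 2) ^ 2 * qK i ι f)
      ≤ 2 * b₁ * (2 * ((d : ℝ) + 1) * kCol (d + 1) (ℓ + 1) + 8 * ((d : ℝ) + 2) ^ 2)
          * (i.cf ^ 2 * ((((ℓ : ℝ) + 1) ^ levV1 i f.src)⁻¹) ^ 2) := by
  have hsplit : ∑ ι, i.w ι * (kCol (d + 1) (ℓ + 1) * boxK i ι f + 8 * ((d : ℝ) + 2) ^ 2 * qK i ι f)
      = kCol (d + 1) (ℓ + 1) * ∑ ι, i.w ι * boxK i ι f + 8 * ((d : ℝ) + 2) ^ 2 * ∑ ι, i.w ι * qK i ι f := by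
    rw [Finset.mul_sum, Finset.mul_sum, ← Finset.sum_add_distrib]
    refine Finset.sum_congr rfl fun ι _ => ?_
    ring
  rw [hsplit]
  have hB := mul_le_mul_of_nonneg_left (colWeight_boxK_le i hb₁ f) (kCol_nonneg (d + 1) (ℓ + 1))
  have hQ := mul_le_mul_of_nonneg_left (colWeight_qK_le i hb₁ f) (by positivity : (0 : ℝ) ≤ 8 * ((d : ℝ) + 2) ^ 2)
  have e : kCol (d + 1) (ℓ + 1) * (4 * ((d : ℝ) + 1) * b₁ * (i.cf ^ 2 * ((((ℓ : ℝ) + 1) ^ levV1 i f.src)⁻¹) ^ 2))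
      + 8 * ((d : ℝ) + 2) ^ 2 * (2 * b₁ * (i.cf ^ 2 * ((((ℓ : ℝ) + 1) ^ levV1 i f.src)⁻¹) ^ 2))
      = 2 * b₁ * (2 * ((d : ℝ) + 1) * kCol (d + 1) (ℓ + 1) + 8 * ((d : ℝ) + 2) ^ 2)
          * (i.cf ^ 2 * ((((ℓ : ℝ) + 1) ^ levV1 i f.src)⁻¹) ^ 2) := by ring
  linarith

end Kernel

/-! ## §3 ★★ The ℓ² closeness of the knit letter to the rebased centre-taxi averaging -/

section Close

open scoped Matrix Matrix.Norms.L2Operator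

variable {d ℓ : ℕ} {hd : 1 ≤ d + 1} {hL : Odd (ℓ + 1) ∧ 1 < ℓ + 1} {b₀ b₁ : ℝ}
variable {N : ℕ} [Nonempty (Fin N)] (i : KIdx d ℓ hd hL b₀ b₁) {G : Subgroup (Matrix (Fin N) (Fin N) ℂ)ˣ}

omit [Nonempty (Fin N)] in
/-- **THE REBASED REFERENCE AS A BUNDLED LETTER** `Q′ := 1♯_T ∘ Q_Y(U)` (def-Y's transport-lift of the identity kernel with the row transports `T_ι`): its value
at `(A, ι)` is `R(T_ι)((Q_Y(U)A)(ι))`. [cite: Balaban1985BackgroundPropagators, (3.12)–(3.13) p.392, bookkeeping] -/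
theorem rebaseRef_apply (T : IBondY i → (Matrix (Fin N) (Fin N) ℂ)ˣ) (parB : BondParY (Matrix (Fin N) (Fin N) ℂ) i)
    (U : CfgY (Matrix (Fin N) (Fin N) ℂ) i) (A : FBondY i → Matrix (Fin N) (Fin N) ℂ) (ι : IBondY i) :
    (trLiftY (1 : Matrix (IBondY i) (IBondY i) ℝ) (fun ι' _ => T ι') ∘ₗ QY i parB U) A ι = B9Eq39Adjoint.R (T ι) (QY i parB U A ι) := by
  classical
  rw [LinearMap.comp_apply, trLiftY_apply, Finset.sum_eq_single ι]
  · rw [Matrix.one_apply_eq, Complex.ofReal_one, one_smul]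
  · intro ι' _ hne
    rw [Matrix.one_apply_ne' hne, Complex.ofReal_zero, zero_smul]
  · intro h; exact absurd (Finset.mem_univ ι) h

/-- ★ one row in HS currency: dag-n06-l's row bound converted by §1, `HS(row ι) ≤ N(α₀′m₀)·Σ_f α₀′q̃_ι(f)·HS(A f)`. [cite: Balaban1985BackgroundPropagators, (3.12)–(3.13) p.392, (3.35) p.396; Balaban1985Averaging, (139)–(147) pp.39–40] -/
theorem hs_row_QknitY_sub_rebase_le (hGU : G ≤ B7Prop2Explicit.unitaryUnits (Matrix (Fin N) (Fin N) ℂ))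
    {U : CfgY (Matrix (Fin N) (Fin N) ℂ) i} {c₀ α₀ : ℝ} (hc : c₀ ≤ 10) (hMα : 0 ≤ (kGeo i).M * α₀)
    (hreg : (bg9KP (Matrix (Fin N) (Fin N) ℂ) G i).Reg335 c₀ α₀ U) {α₀' : ℝ} (hα' : 0 < α₀') (hαQ : α₀' ≤ alphaQ (d + 1) (ℓ + 1))
    (hK : Kpl i ((kGeo i).M * α₀) * (kGeo i).L ^ 4 < α₀') (T : IBondY i → (Matrix (Fin N) (Fin N) ℂ)ˣ)
    (hT : ∀ ι, T ι = (parTaxiV U (B15DeterminingSets.embIter (ι.1.1 : ℕ) ι.1.2.src)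
      (B10Eq27TorusAxialLog.transl (0 : Site (PV d ℓ i.m i.K hd hL) 0) (B7Prop1Local.loK (ℓ + 1) (ι.1.1 : ℕ) (zSrc i ι))))⁻¹)
    (A : FBondY i → Matrix (Fin N) (Fin N) ℂ) (ι : IBondY i) :
    ∑ p, ∑ q, ‖(QknitY i U A ι - B9Eq39Adjoint.R (T ι) (QY i (parBY i) U A ι)) p q‖ ^ 2
      ≤ (N : ℝ) * (α₀' * (2 * ((d : ℝ) + 1) * kCol (d + 1) (ℓ + 1) + 8 * ((d : ℝ) + 2) ^ 2))
          * ∑ f, (α₀' * (kCol (d + 1) (ℓ + 1) * boxK i ι f + 8 * ((d : ℝ) + 2) ^ 2 * qK i ι f)) * ∑ p, ∑ q, ‖A f p q‖ ^ 2 := by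
  have hG1 : ∀ u : (Matrix (Fin N) (Fin N) ℂ)ˣ, u ∈ G → ‖(u : Matrix (Fin N) (Fin N) ℂ)‖ ≤ 1 :=
    fun u hu => (B9Ineq349SiteFromConv342.contractive_of_mem hGU hu).1
  have h := norm_QknitY_sub_R_QY_parBY_le i hG1 hGU hc hMα hreg hα' hαQ hK A ι
  rw [← hT ι] at h
  have h' : ‖QknitY i U A ι - B9Eq39Adjoint.R (T ι) (QY i (parBY i) U A ι)‖
      ≤ ∑ f, (α₀' * (kCol (d + 1) (ℓ + 1) * boxK i ι f + 8 * ((d : ℝ) + 2) ^ 2 * qK i ι f)) * ‖A f‖ := by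
    refine h.trans (le_of_eq ?_)
    rw [Finset.mul_sum]
    exact Finset.sum_congr rfl fun f _ => by ring
  have hc0 : ∀ f, 0 ≤ α₀' * (kCol (d + 1) (ℓ + 1) * boxK i ι f + 8 * ((d : ℝ) + 2) ^ 2 * qK i ι f) :=
    fun f => mul_nonneg hα'.le (qtilde_nonneg i ι f)
  have hhs := hs_le_of_norm_le_sum _ _ hc0 A h'
  have hmass : ∑ f, α₀' * (kCol (d + 1) (ℓ + 1) * boxK i ι f + 8 * ((d : ℝ) + 2) ^ 2 * qK i ι f)
      ≤ α₀' * (2 * ((d : ℝ) + 1) * kCol (d + 1) (ℓ + 1) + 8 * ((d : ℝ) + 2) ^ 2) := by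
    rw [← Finset.mul_sum]
    exact mul_le_mul_of_nonneg_left (qtilde_rowMass_le i ι) hα'.le
  have hS : 0 ≤ ∑ f, (α₀' * (kCol (d + 1) (ℓ + 1) * boxK i ι f + 8 * ((d : ℝ) + 2) ^ 2 * qK i ι f)) * ∑ p, ∑ q, ‖A f p q‖ ^ 2 :=
    Finset.sum_nonneg fun f _ => mul_nonneg (hc0 f) (hs_nonneg (A f))
  exact hhs.trans (mul_le_mul_of_nonneg_right (mul_le_mul_of_nonneg_left hmass (Nat.cast_nonneg N)) hS)

omit [Nonempty (Fin N)] in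
/-- the column weight of the `α₀′`-scaled kernel. [cite: Balaban1985BackgroundPropagators, (3.15) p.393, bookkeeping] -/
theorem colWeight_scaled_le (hb₁ : 0 ≤ b₁) {α₀' : ℝ} (hα' : 0 ≤ α₀') (f : FBondY i) :
    ∑ ι, i.w ι * (α₀' * (kCol (d + 1) (ℓ + 1) * boxK i ι f + 8 * ((d : ℝ) + 2) ^ 2 * qK i ι f))
      ≤ α₀' * (2 * b₁ * (2 * ((d : ℝ) + 1) * kCol (d + 1) (ℓ + 1) + 8 * ((d : ℝ) + 2) ^ 2)
          * (i.cf ^ 2 * ((((ℓ : ℝ) + 1) ^ levV1 i f.src)⁻¹) ^ 2)) := by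
  have e : ∑ ι, i.w ι * (α₀' * (kCol (d + 1) (ℓ + 1) * boxK i ι f + 8 * ((d : ℝ) + 2) ^ 2 * qK i ι f))
      = α₀' * ∑ ι, i.w ι * (kCol (d + 1) (ℓ + 1) * boxK i ι f + 8 * ((d : ℝ) + 2) ^ 2 * qK i ι f) := by
    rw [Finset.mul_sum]
    exact Finset.sum_congr rfl fun ι _ => by ring
  rw [e]
  exact mul_le_mul_of_nonneg_left (qtilde_colWeight_le i hb₁ f) hα'

/-- ★★ **THE ℓ²-CLOSENESS OF `Q(U) = QknitY` TO THE REBASED `Q_Y(U)` ON THE CLASS (3.35)**: for a member background `U ∈ (bg9KP … G i).Reg335 c₀ α₀`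
(`G ≤ U(N)`, `c₀ ≤ 10`, `0 ≤ Mα₀`), x-free numerics `0 < α₀′ ≤ α_Q(d+1,L)`, `K_pl(Mα₀)L⁴ < α₀′`, `b₁ ≥ 0`, the row transports `T_ι = U(Γ^{taxi})⁻¹` of
dag-n06-l and every bond function `A`: `Σ_ι w(ι)·HS((Q(U)A)(ι) − R(T_ι)((Q_Y(U)A)(ι))) ≤ (α₀′m₀)²·2Nb₁·Σ_b c_f²(L^{lev b})⁻²·HS(A b)`,
`m₀ = 2(d+1)K(d+1,L) + 8(d+2)²` (rows by §1, columns by §2). [cite: Balaban1985BackgroundPropagators, (3.12)–(3.13) p.392, (3.14)–(3.15) p.393, (3.115) p.419, (3.35) p.396; Balaban1985Averaging, (139)–(147) pp.39–40] -/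
theorem trIP_w_QknitY_sub_rebase_le (hGU : G ≤ B7Prop2Explicit.unitaryUnits (Matrix (Fin N) (Fin N) ℂ)) (hb₁ : 0 ≤ b₁)
    {U : CfgY (Matrix (Fin N) (Fin N) ℂ) i} {c₀ α₀ : ℝ} (hc : c₀ ≤ 10) (hMα : 0 ≤ (kGeo i).M * α₀)
    (hreg : (bg9KP (Matrix (Fin N) (Fin N) ℂ) G i).Reg335 c₀ α₀ U) {α₀' : ℝ} (hα' : 0 < α₀') (hαQ : α₀' ≤ alphaQ (d + 1) (ℓ + 1))
    (hK : Kpl i ((kGeo i).M * α₀) * (kGeo i).L ^ 4 < α₀') (T : IBondY i → (Matrix (Fin N) (Fin N) ℂ)ˣ)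
    (hT : ∀ ι, T ι = (parTaxiV U (B15DeterminingSets.embIter (ι.1.1 : ℕ) ι.1.2.src)
      (B10Eq27TorusAxialLog.transl (0 : Site (PV d ℓ i.m i.K hd hL) 0) (B7Prop1Local.loK (ℓ + 1) (ι.1.1 : ℕ) (zSrc i ι))))⁻¹)
    (A : FBondY i → Matrix (Fin N) (Fin N) ℂ) :
    trIP i.w (fun ι => QknitY i U A ι - B9Eq39Adjoint.R (T ι) (QY i (parBY i) U A ι))
        (fun ι => QknitY i U A ι - B9Eq39Adjoint.R (T ι) (QY i (parBY i) U A ι))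
      ≤ (α₀' * (2 * ((d : ℝ) + 1) * kCol (d + 1) (ℓ + 1) + 8 * ((d : ℝ) + 2) ^ 2)) ^ 2 * (2 * (N : ℝ) * b₁)
          * ∑ b, (i.cf ^ 2 * ((((ℓ : ℝ) + 1) ^ levV1 i b.src)⁻¹) ^ 2) * ∑ a, ∑ c, ‖A b a c‖ ^ 2 := by
  have hm₀0 : 0 ≤ 2 * ((d : ℝ) + 1) * kCol (d + 1) (ℓ + 1) + 8 * ((d : ℝ) + 2) ^ 2 := by
    have := kCol_nonneg (d + 1) (ℓ + 1); positivity
  have hrow := fun ι => hs_row_QknitY_sub_rebase_le i hGU hc hMα hreg hα' hαQ hK T hT A ι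
  rw [trIP_self_eq_sum]
  calc ∑ ι, i.w ι * ∑ p, ∑ q, ‖(QknitY i U A ι - B9Eq39Adjoint.R (T ι) (QY i (parBY i) U A ι)) p q‖ ^ 2
      ≤ ∑ ι, i.w ι * ((N : ℝ) * (α₀' * (2 * ((d : ℝ) + 1) * kCol (d + 1) (ℓ + 1) + 8 * ((d : ℝ) + 2) ^ 2))
          * ∑ f, (α₀' * (kCol (d + 1) (ℓ + 1) * boxK i ι f + 8 * ((d : ℝ) + 2) ^ 2 * qK i ι f)) * ∑ p, ∑ q, ‖A f p q‖ ^ 2) :=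
        Finset.sum_le_sum fun ι _ => mul_le_mul_of_nonneg_left (hrow ι) (i.hw ι).le
    _ = (N : ℝ) * (α₀' * (2 * ((d : ℝ) + 1) * kCol (d + 1) (ℓ + 1) + 8 * ((d : ℝ) + 2) ^ 2))
          * ∑ ι, i.w ι * ∑ f, (α₀' * (kCol (d + 1) (ℓ + 1) * boxK i ι f + 8 * ((d : ℝ) + 2) ^ 2 * qK i ι f)) * ∑ p, ∑ q, ‖A f p q‖ ^ 2 := by
        rw [Finset.mul_sum]
        exact Finset.sum_congr rfl fun ι _ => by ring
    _ = (N : ℝ) * (α₀' * (2 * ((d : ℝ) + 1) * kCol (d + 1) (ℓ + 1) + 8 * ((d : ℝ) + 2) ^ 2))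
          * ∑ f, (∑ ι, i.w ι * (α₀' * (kCol (d + 1) (ℓ + 1) * boxK i ι f + 8 * ((d : ℝ) + 2) ^ 2 * qK i ι f))) * ∑ p, ∑ q, ‖A f p q‖ ^ 2 := by
        rw [sum_mul_sum_mul_comm i.w (fun ι f => α₀' * (kCol (d + 1) (ℓ + 1) * boxK i ι f + 8 * ((d : ℝ) + 2) ^ 2 * qK i ι f))
          (fun f => ∑ p, ∑ q, ‖A f p q‖ ^ 2)]
    _ ≤ (N : ℝ) * (α₀' * (2 * ((d : ℝ) + 1) * kCol (d + 1) (ℓ + 1) + 8 * ((d : ℝ) + 2) ^ 2))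
          * ∑ f, (α₀' * (2 * b₁ * (2 * ((d : ℝ) + 1) * kCol (d + 1) (ℓ + 1) + 8 * ((d : ℝ) + 2) ^ 2)
              * (i.cf ^ 2 * ((((ℓ : ℝ) + 1) ^ levV1 i f.src)⁻¹) ^ 2))) * ∑ p, ∑ q, ‖A f p q‖ ^ 2 := by
        refine mul_le_mul_of_nonneg_left (Finset.sum_le_sum fun f _ =>
          mul_le_mul_of_nonneg_right (colWeight_scaled_le i hb₁ hα'.le f) (hs_nonneg (A f))) (by positivity)
    _ = (α₀' * (2 * ((d : ℝ) + 1) * kCol (d + 1) (ℓ + 1) + 8 * ((d : ℝ) + 2) ^ 2)) ^ 2 * (2 * (N : ℝ) * b₁)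
          * ∑ b, (i.cf ^ 2 * ((((ℓ : ℝ) + 1) ^ levV1 i b.src)⁻¹) ^ 2) * ∑ a, ∑ c, ‖A b a c‖ ^ 2 := by
        rw [Finset.mul_sum, Finset.mul_sum]
        exact Finset.sum_congr rfl fun f _ => by ring

end Close

/-! ## §4 ★★★ Row 17 at the knit letter, at section-carrying members, from adjointness and x-free numerics -/

section Record

open scoped Matrix Matrix.Norms.L2Operator
open B7Prop2SpecialUnitary

variable {N : ℕ} [Nonempty (Fin N)] (θ : Stage3Params) (Mstar : ℕ)

/-- ★★★ **THEOREM 3.11 FOR `Δ_a` AT THE KNIT LETTER ON (3.35), AT EVERY SECTION-CARRYING MEMBER**: `∃ M₁ a₁ γ > 0` (of `formGap_deltaAY_of_regYP335_section`):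
for `β` onto, `M₁ ≦ M`, `0 < α₀`, `Mα₀ ≦ a₁`, `U ∈ (bg9YP … x).Reg335 c₃₅ α₀`, any partner `𝔮s` adjoint to `QknitY x` at `U`, and x-free numerics `0 < α₀′ ≤ α_Q`,
`K_pl(Mα₀)L⁴ < α₀′`, `δ(2√(2b₁)+δ) < γ` (`δ = α₀′m₀√(2Nb₁)`): `PosDefTr 1 (deltaAQY x (QknitY x) 𝔮s parSymY (GpY parSymY) U)` — row 17 at `𝔮 := qKnitOfRecord`.
[cite: Balaban1985BackgroundPropagators, Thm 3.11 p.416; Thm 3.3 p.399; (3.26) p.395; (3.12)–(3.13) p.392, (3.14)–(3.15) p.393; (3.115) p.419; (3.35) p.396; Balaban1985Averaging, (139)–(147) pp.39–40] -/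
theorem posDefTr_deltaAQY_QknitY_of_regYP335_section :
    ∃ M₁ a₁ γ : ℝ, 0 < M₁ ∧ 0 < a₁ ∧ 0 < γ ∧
    ∀ (x : MemberY θ.d₆ θ.ℓ₆ θ.hd' θ.hL' θ.b₀ θ.b₁ Mstar), Function.Surjective (β x.hN x.D x.hk) → M₁ ≤ (geo9Y x).M →
      ∀ α₀ : ℝ, 0 < α₀ → (geo9Y x).M * α₀ ≤ a₁ →
      ∀ U : CfgY (Matrix (Fin N) (Fin N) ℂ) x.toKIdx,
        (bg9YP (Matrix (Fin N) (Fin N) ℂ) (specialUnitaryUnits (Fin N)) x).Reg335 c35Y α₀ U →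
        ∀ (𝔮s : CfgY (Matrix (Fin N) (Fin N) ℂ) x.toKIdx →
              ((IBondY x.toKIdx → Matrix (Fin N) (Fin N) ℂ) →ₗ[ℂ] (FBondY x.toKIdx → Matrix (Fin N) (Fin N) ℂ))),
          IsAdjTr (fun _ => (1 : ℝ)) (fun _ => (1 : ℝ)) (QknitY x.toKIdx U) (𝔮s U) →
        ∀ α₀' : ℝ, 0 < α₀' → α₀' ≤ alphaQ (θ.d₆ + 1) (θ.ℓ₆ + 1) →
          Kpl x.toKIdx ((geo9Y x).M * α₀) * (((θ.ℓ₆ : ℝ) + 1)) ^ 4 < α₀' →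
          (α₀' * (2 * ((θ.d₆ : ℝ) + 1) * kCol (θ.d₆ + 1) (θ.ℓ₆ + 1) + 8 * ((θ.d₆ : ℝ) + 2) ^ 2) * Real.sqrt (2 * (N : ℝ) * θ.b₁))
              * (2 * Real.sqrt (2 * θ.b₁)
                + α₀' * (2 * ((θ.d₆ : ℝ) + 1) * kCol (θ.d₆ + 1) (θ.ℓ₆ + 1) + 8 * ((θ.d₆ : ℝ) + 2) ^ 2) * Real.sqrt (2 * (N : ℝ) * θ.b₁)) < γ →
          PosDefTr (fun _ => (1 : ℝ))
            (deltaAQY x.toKIdx (QknitY x.toKIdx) 𝔮s (parSymY x.toKIdx) (GpY x.toKIdx (parSymY x.toKIdx)) U) := by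
  have hN : 1 ≤ N := Fin.pos_iff_nonempty.2 inferInstance
  obtain ⟨M₁, a₁, γ, hM₁, ha₁, hγ, h⟩ := posDefTr_deltaAQY_of_close_of_regYP335_section (N := N) θ Mstar hN
  refine ⟨M₁, a₁, γ, hM₁, ha₁, hγ, fun x hsurj hM α₀ hα ha U hU 𝔮s hQ α₀' hα' hαQ hK hβ => ?_⟩
  have hGU : specialUnitaryUnits (Fin N) ≤ B7Prop2Explicit.unitaryUnits (Matrix (Fin N) (Fin N) ℂ) := specialUnitaryUnits_le_unitaryUnits
  have hb₁ : 0 ≤ θ.b₁ := le_trans θ.hb.1.le θ.hb.2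
  have hreg : (bg9KP (Matrix (Fin N) (Fin N) ℂ) (specialUnitaryUnits (Fin N)) x.toKIdx).Reg335 c35Y α₀ U := hU.1
  have hMα : 0 ≤ (kGeo x.toKIdx).M * α₀ := mul_nonneg (B9Thm39OneCubeReadingAtLettersY.geo9Y_M_nonneg θ Mstar x) hα.le
  have hLK : (kGeo x.toKIdx).L = (θ.ℓ₆ : ℝ) + 1 := by show (((θ.ℓ₆ + 1 : ℕ) : ℝ)) = _; push_cast; ring
  have hK' : Kpl x.toKIdx ((kGeo x.toKIdx).M * α₀) * (kGeo x.toKIdx).L ^ 4 < α₀' := by rw [hLK]; exact hK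
  -- the row transports of dag-n06-l, kept opaque
  obtain ⟨T, hT⟩ : ∃ T : IBondY x.toKIdx → (Matrix (Fin N) (Fin N) ℂ)ˣ, ∀ ι, T ι =
      (parTaxiV U (B15DeterminingSets.embIter (ι.1.1 : ℕ) ι.1.2.src)
        (B10Eq27TorusAxialLog.transl (0 : Site (PV θ.d₆ θ.ℓ₆ x.toKIdx.m x.toKIdx.K θ.hd' θ.hL') 0)
          (B7Prop1Local.loK (θ.ℓ₆ + 1) (ι.1.1 : ℕ) (zSrc x.toKIdx ι))))⁻¹ := ⟨_, fun _ => rfl⟩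
  have hTc : ∀ ι, ‖(T ι : Matrix (Fin N) (Fin N) ℂ)‖ ≤ 1 ∧ ‖(((T ι)⁻¹ : (Matrix (Fin N) (Fin N) ℂ)ˣ) : Matrix (Fin N) (Fin N) ℂ)‖ ≤ 1 := by
    intro ι
    rw [hT ι]
    exact B9Ineq349SiteFromConv342.contractive_of_mem hGU (rebase_mem x.toKIdx hU.1.1 ι)
  have hm₀0 : 0 ≤ 2 * ((θ.d₆ : ℝ) + 1) * kCol (θ.d₆ + 1) (θ.ℓ₆ + 1) + 8 * ((θ.d₆ : ℝ) + 2) ^ 2 := by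
    have := kCol_nonneg (θ.d₆ + 1) (θ.ℓ₆ + 1); positivity
  have hδ0 : 0 ≤ α₀' * (2 * ((θ.d₆ : ℝ) + 1) * kCol (θ.d₆ + 1) (θ.ℓ₆ + 1) + 8 * ((θ.d₆ : ℝ) + 2) ^ 2) * Real.sqrt (2 * (N : ℝ) * θ.b₁) := by
    positivity
  refine h x hsurj hM α₀ hα ha U hU (QknitY x.toKIdx) 𝔮s hQ
    (trLiftY (1 : Matrix (IBondY x.toKIdx) (IBondY x.toKIdx) ℝ) (fun ι' _ => T ι') ∘ₗ QY x.toKIdx (parBY x.toKIdx) U) T hTc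
    (fun A ι => rebaseRef_apply x.toKIdx T (parBY x.toKIdx) U A ι) _ hδ0 (fun A => ?_) hβ
  -- the closeness in the `trIP` currency
  have hclose := trIP_w_QknitY_sub_rebase_le x.toKIdx hGU hb₁ (show c35Y ≤ 10 by norm_num [c35Y]) hMα hreg hα' hαQ hK' T hT A
  have hfun : (QknitY x.toKIdx U - trLiftY (1 : Matrix (IBondY x.toKIdx) (IBondY x.toKIdx) ℝ) (fun ι' _ => T ι') ∘ₗ QY x.toKIdx (parBY x.toKIdx) U) A
      = fun ι => QknitY x.toKIdx U A ι - B9Eq39Adjoint.R (T ι) (QY x.toKIdx (parBY x.toKIdx) U A ι) := by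
    funext ι
    rw [LinearMap.sub_apply, Pi.sub_apply, rebaseRef_apply]
  have hδsq : (α₀' * (2 * ((θ.d₆ : ℝ) + 1) * kCol (θ.d₆ + 1) (θ.ℓ₆ + 1) + 8 * ((θ.d₆ : ℝ) + 2) ^ 2) * Real.sqrt (2 * (N : ℝ) * θ.b₁)) ^ 2
      = (α₀' * (2 * ((θ.d₆ : ℝ) + 1) * kCol (θ.d₆ + 1) (θ.ℓ₆ + 1) + 8 * ((θ.d₆ : ℝ) + 2) ^ 2)) ^ 2 * (2 * (N : ℝ) * θ.b₁) := by
    rw [mul_pow, Real.sq_sqrt (by positivity)]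
  rw [hfun, hδsq]
  exact hclose

/-- ★★★ **THE SAME AT `SCMemberY` BY NAME** (n06-c's carrier of section-carrying members). [cite: Balaban1985BackgroundPropagators, Thm 3.11 p.416; Balaban1984PropagatorsII, (2.45) p.231] -/
theorem posDefTr_deltaAQY_QknitY_at_scMemberY :
    ∃ M₁ a₁ γ : ℝ, 0 < M₁ ∧ 0 < a₁ ∧ 0 < γ ∧
    ∀ (j : SCMemberY θ.d₆ θ.ℓ₆ θ.hd' θ.hL' θ.b₀ θ.b₁ Mstar), M₁ ≤ (geo9Y j.val).M →
      ∀ α₀ : ℝ, 0 < α₀ → (geo9Y j.val).M * α₀ ≤ a₁ →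
      ∀ U : CfgY (Matrix (Fin N) (Fin N) ℂ) j.val.toKIdx,
        (bg9YP (Matrix (Fin N) (Fin N) ℂ) (specialUnitaryUnits (Fin N)) j.val).Reg335 c35Y α₀ U →
        ∀ (𝔮s : CfgY (Matrix (Fin N) (Fin N) ℂ) j.val.toKIdx →
              ((IBondY j.val.toKIdx → Matrix (Fin N) (Fin N) ℂ) →ₗ[ℂ] (FBondY j.val.toKIdx → Matrix (Fin N) (Fin N) ℂ))),
          IsAdjTr (fun _ => (1 : ℝ)) (fun _ => (1 : ℝ)) (QknitY j.val.toKIdx U) (𝔮s U) →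
        ∀ α₀' : ℝ, 0 < α₀' → α₀' ≤ alphaQ (θ.d₆ + 1) (θ.ℓ₆ + 1) →
          Kpl j.val.toKIdx ((geo9Y j.val).M * α₀) * (((θ.ℓ₆ : ℝ) + 1)) ^ 4 < α₀' →
          (α₀' * (2 * ((θ.d₆ : ℝ) + 1) * kCol (θ.d₆ + 1) (θ.ℓ₆ + 1) + 8 * ((θ.d₆ : ℝ) + 2) ^ 2) * Real.sqrt (2 * (N : ℝ) * θ.b₁))
              * (2 * Real.sqrt (2 * θ.b₁)
                + α₀' * (2 * ((θ.d₆ : ℝ) + 1) * kCol (θ.d₆ + 1) (θ.ℓ₆ + 1) + 8 * ((θ.d₆ : ℝ) + 2) ^ 2) * Real.sqrt (2 * (N : ℝ) * θ.b₁)) < γ →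
          PosDefTr (fun _ => (1 : ℝ))
            (deltaAQY j.val.toKIdx (QknitY j.val.toKIdx) 𝔮s (parSymY j.val.toKIdx) (GpY j.val.toKIdx (parSymY j.val.toKIdx)) U) := by
  obtain ⟨M₁, a₁, γ, hM₁, ha₁, hγ, h⟩ := posDefTr_deltaAQY_QknitY_of_regYP335_section (N := N) θ Mstar
  exact ⟨M₁, a₁, γ, hM₁, ha₁, hγ, fun j hM α₀ hα ha U hU 𝔮s hQ α₀' hα' hαQ hK hβ =>
    h j.val j.surjective_beta hM α₀ hα ha U hU 𝔮s hQ α₀' hα' hαQ hK hβ⟩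

end Record

end Literature.MathematicalPhysics.QuantumFieldTheory.Balaban1983to89.B9Thm311PosDefQknitOfRegYP335AtLettersY

end
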